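import Mathlib
import Literature.Analysis.FluidPDE.HardSphereCollisionRecord
import Literature.Analysis.FluidPDE.HardSphereTorusMeasure
import Literature.Analysis.FluidPDE.HardSphereAlexander
import Literature.MathematicalPhysics.KineticTheory.HardSphereEuler
import Literature.MathematicalPhysics.KineticTheory.HardSphereEulerProofs
import Literature.MathematicalPhysics.KineticTheory.HardSphereUniformGas
import Summits.AtomisticToContinuum.HydrodynamicLimit.Theorems.JParityClosureEvenStressEnskogExchangeable
import Summits.AtomisticToContinuum.HydrodynamicLimit.Theorems.OneFlightGossipEngineOneFlightLayeredChaosFirstFlightGhostTransfer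
import HarnessLib

/-!
# `OneFlightGossipEngine.OneFlightLayeredChaos` — the first-flight ghost event has probability `≤ 1/N`
(crux stmt-AtomisticToContinuum-14535, line `Sketch`; a brick of the first-rung transfer
`TwoDirectionGhostInput → FirstFlightGhostInput` of lead cycle c4, wave 2; registered stub
`prod_measure_firstFlightGhostEvent_le_inv`).

Let `μ = posGibbsMeasure 1 ε (N+1)` (hard-core-uniform positions, `ε = hsDiameter σ N`), `γ = ⊗ᵢ N(0, θ₀ id)`
(velocities) and `F = firstFlightGhostEvent Ψ i j emb w ⊆ Config (N+1)` the GHOST EVENT of the pair `j ≠ i`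
(`…FirstFlightGhostInput`).  CLAIM: `(μ ⊗ γ) {zipConfig ∈ F} ≤ 1/N`, uniformly in the window `w`, the ghost flow `Ψ`
and the enumeration `emb` of the other labels.  Proof by LABEL EXCHANGEABILITY, no dynamical estimate:

* the product law pushed forward by `zipConfig` is the rung-0 local Gibbs law `P` (`localGibbsMeasure_rung0_eq_map`),
  `P ≪ Liouville`; fix ANY `(N+1)`-body flow `Φ` (Alexander, `HardSphereFlow.nonempty_torus_holds`, `ε < 1/2`);
* a.e. identification (`measure_firstFlightGhostEvent_eq_of_ac`): `P F(i, j', emb') = P E_{j'}` where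
  `E_{j'} = Φ.good ∩ {t₀(i) ∈ (0, w], first partner of i is j', j' fresh}` (`good_inter_firstFlightGhostEvent_eq` on the
  `P`-conull set of `Φ`-good data with `Ψ`-good ghost part, `ae_comp_emb_mem_good`);
* the events `E_{j'}`, `j' ≠ i`, are pairwise disjoint (the first partner is ONE label), so `∑_{j' ≠ i} P E_{j'} ≤ 1`;
* symmetry: for `j' ≠ i` the transposition `π = swap j j'` fixes `i`, and `{z | z ∘ π ∈ F(i, j, emb)} = F(i, j', π ∘ emb)`
  DEFINITIONALLY (same ghost flow `Ψ`; `comp_perm_mem_firstFlightGhostEvent_iff`), while `z ↦ z ∘ π` preserves `P`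
  (`EvenStressEnskog.measurePreserving_comp_perm_localGibbsLaw`); hence `P E_{j'} = P F(i, j, emb)` for all `N` labels
  `j' ≠ i`, and `N · P F ≤ 1`.
-/

open scoped BigOperators ENNReal Topology
open MeasureTheory Set Filter
open Literature.Analysis.FluidPDE Literature.MathematicalPhysics.KineticTheory
open Summit.AtomisticToContinuum.HydrodynamicLimit.Theorems

namespace Summit.AtomisticToContinuum.HydrodynamicLimit.Theorems.OLC

noncomputable section

/-! ## Relabelling the ghost event -/

section Relabel

variable {σ : ℝ} {N m n : ℕ}

/-- **The entrance time under relabelling**: the entrance time of the free flights of `a, b` in `z ∘ π` is the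
entrance time of the free flights of `π a, π b` in `z` (definitional). [folklore] -/
theorem freeEntranceTime_comp_perm (ε : ℝ) (π : Equiv.Perm (Fin n)) (z : Config n (Fin 3) T3) (a b : Fin n) :
    freeEntranceTime ε (z ∘ π : Config n (Fin 3) T3) a b = freeEntranceTime ε z (π a) (π b) := rfl

/-- **The ghost event under relabelling** (definitional): `z ∘ π` lies in the ghost event of the pair `(i, j)` with
enumeration `emb` iff `z` lies in the ghost event of the pair `(π i, π j)` with enumeration `π ∘ emb`, for the SAME
ghost flow `Ψ` (`(z ∘ π) ∘ emb = z ∘ (π ∘ emb)`, `freeFlight t (z ∘ π) k = freeFlight t z (π k)`). [folklore] -/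
theorem comp_perm_mem_firstFlightGhostEvent_iff (Ψ : HardSphereFlow (Torus.geometry (Fin 3)) (hsDiameter σ N) m)
    (i j : Fin (N + 1)) (emb : Fin m ↪ Fin (N + 1)) (w : ℝ) (π : Equiv.Perm (Fin (N + 1)))
    (z : Config (N + 1) (Fin 3) T3) :
    (z ∘ π : Config (N + 1) (Fin 3) T3) ∈ firstFlightGhostEvent Ψ i j emb w ↔
      z ∈ firstFlightGhostEvent Ψ (π i) (π j) (emb.trans π.toEmbedding) w :=
  Iff.rfl

/-- **Preimage of the ghost event under relabelling**: `{z | z ∘ π ∈ F(Ψ, i, j, emb, w)} = F(Ψ, π i, π j, π ∘ emb, w)`.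
[folklore] -/
theorem preimage_comp_perm_firstFlightGhostEvent (Ψ : HardSphereFlow (Torus.geometry (Fin 3)) (hsDiameter σ N) m)
    (i j : Fin (N + 1)) (emb : Fin m ↪ Fin (N + 1)) (w : ℝ) (π : Equiv.Perm (Fin (N + 1))) :
    (fun z : Config (N + 1) (Fin 3) T3 => (z ∘ π : Config (N + 1) (Fin 3) T3)) ⁻¹' firstFlightGhostEvent Ψ i j emb w =
      firstFlightGhostEvent Ψ (π i) (π j) (emb.trans π.toEmbedding) w :=
  Set.ext fun z => comp_perm_mem_firstFlightGhostEvent_iff Ψ i j emb w π z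

/-- **Range of the relabelled enumeration**: if `emb` enumerates the labels `∉ {i, j}`, then `π ∘ emb` enumerates
the labels `∉ {π i, π j}`. [folklore] -/
theorem exists_emb_trans_perm_iff {i j : Fin (N + 1)} (emb : Fin m ↪ Fin (N + 1))
    (hemb : ∀ k : Fin (N + 1), (∃ l, emb l = k) ↔ (k ≠ i ∧ k ≠ j)) (π : Equiv.Perm (Fin (N + 1)))
    (k : Fin (N + 1)) :
    (∃ l, (emb.trans π.toEmbedding) l = k) ↔ (k ≠ π i ∧ k ≠ π j) := by
  have h1 : (∃ l, (emb.trans π.toEmbedding) l = k) ↔ ∃ l, emb l = π.symm k := by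
    refine exists_congr fun l => ?_
    rw [Function.Embedding.trans_apply, Equiv.coe_toEmbedding, Equiv.apply_eq_iff_eq_symm_apply]
  rw [h1, hemb (π.symm k), Ne, Ne, Equiv.symm_apply_eq, Equiv.symm_apply_eq]

end Relabel

/-! ## Identification, disjointness, symmetry -/

section Events

variable {σ : ℝ} {N m : ℕ}

/-- **A.e. identification of the ghost event with the first-flight event of the pair.** For every law `P ≪ Liouville`
of `N + 1` spheres, every `(N+1)`-body hard-sphere flow `Φ`, every ghost flow `Ψ` and enumeration `emb` of the labels
`∉ {i, j}` (`i ≠ j`): `P (ghost event) = P (Φ.good ∩ {t₀(i) ∈ (0, w], first partner j, j fresh})` — the two events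
agree on the `P`-conull set of `Φ`-good data with `Ψ`-good ghost part (`good_inter_firstFlightGhostEvent_eq`,
`Φ.measure_compl_good`, `ae_comp_emb_mem_good`). [folklore] -/
theorem measure_firstFlightGhostEvent_eq_of_ac
    (Φ : HardSphereFlow (Torus.geometry (Fin 3)) (hsDiameter σ N) (N + 1))
    (Ψ : HardSphereFlow (Torus.geometry (Fin 3)) (hsDiameter σ N) m) {i j : Fin (N + 1)} (hij : i ≠ j)
    (emb : Fin m ↪ Fin (N + 1)) (hemb : ∀ k : Fin (N + 1), (∃ l, emb l = k) ↔ (k ≠ i ∧ k ≠ j)) (w : ℝ)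
    {P : Measure (Config (N + 1) (Fin 3) T3)}
    (hP : P ≪ liouville (Torus.geometry (Fin 3)) (N + 1) (hsDiameter σ N)) :
    P (firstFlightGhostEvent Ψ i j emb w) =
      P (Φ.good ∩ {z : Config (N + 1) (Fin 3) T3 | Φ.nthCollisionTimeOf i 0 z ∈ Set.Ioc 0 w ∧
          Φ.nthPartnerOf i 0 z = j ∧ ∀ u ∈ Set.Ioo 0 (Φ.nthCollisionTimeOf i 0 z),
            ¬ Participates (Torus.geometry (Fin 3)) (hsDiameter σ N) (Φ.flow u z) j}) := by
  have h1 : P Φ.goodᶜ = 0 := hP Φ.measure_compl_good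
  have h2 : P {z : Config (N + 1) (Fin 3) T3 | (z ∘ emb : Config m (Fin 3) T3) ∈ Ψ.good}ᶜ = 0 := by
    rw [Set.compl_setOf]
    exact ae_iff.1 (ae_comp_emb_mem_good Ψ emb hP)
  rw [← measure_inter_conull (s := firstFlightGhostEvent Ψ i j emb w) h1,
    Set.inter_comm (firstFlightGhostEvent Ψ i j emb w), good_inter_firstFlightGhostEvent_eq Φ Ψ emb hij hemb w,
    Set.inter_comm {z : Config (N + 1) (Fin 3) T3 | (z ∘ emb : Config m (Fin 3) T3) ∈ Ψ.good},
    measure_inter_conull h2]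

/-- **The first-flight events of the pairs `(i, j')` are pairwise disjoint in `j'`**: the first partner of `i` is
one label. [folklore] -/
theorem pairwiseDisjoint_firstFlightPairEvent
    (Φ : HardSphereFlow (Torus.geometry (Fin 3)) (hsDiameter σ N) (N + 1)) (i : Fin (N + 1)) (w : ℝ)
    (S : Set (Fin (N + 1))) :
    S.PairwiseDisjoint fun j' => Φ.good ∩ {z : Config (N + 1) (Fin 3) T3 |
      Φ.nthCollisionTimeOf i 0 z ∈ Set.Ioc 0 w ∧ Φ.nthPartnerOf i 0 z = j' ∧
        ∀ u ∈ Set.Ioo 0 (Φ.nthCollisionTimeOf i 0 z),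
          ¬ Participates (Torus.geometry (Fin 3)) (hsDiameter σ N) (Φ.flow u z) j'} := by
  intro a _ b _ hab
  show Disjoint (Φ.good ∩ _) (Φ.good ∩ _)
  exact Set.disjoint_left.2 fun z hza hzb => hab (hza.2.2.1.symm.trans hzb.2.2.1)

/-- **The first-flight events of the pairs `(i, j')`, `j' ≠ i`, have total probability `≤ 1`** (pairwise disjoint
and measurable, `measurableSet_firstFlightPairEvent`). [folklore] -/
theorem sum_measure_firstFlightPairEvent_le_one
    (Φ : HardSphereFlow (Torus.geometry (Fin 3)) (hsDiameter σ N) (N + 1)) (i : Fin (N + 1)) (w : ℝ)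
    (P : Measure (Config (N + 1) (Fin 3) T3)) [IsProbabilityMeasure P] :
    ∑ j' ∈ Finset.univ.erase i, P (Φ.good ∩ {z : Config (N + 1) (Fin 3) T3 |
      Φ.nthCollisionTimeOf i 0 z ∈ Set.Ioc 0 w ∧ Φ.nthPartnerOf i 0 z = j' ∧
        ∀ u ∈ Set.Ioo 0 (Φ.nthCollisionTimeOf i 0 z),
          ¬ Participates (Torus.geometry (Fin 3)) (hsDiameter σ N) (Φ.flow u z) j'}) ≤ 1 := by
  rw [← measure_biUnion_finset (pairwiseDisjoint_firstFlightPairEvent Φ i w _)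
    (fun j' _ => measurableSet_firstFlightPairEvent Φ i j' w)]
  exact prob_le_one

/-- **Label symmetry of the ghost event under the local Gibbs law.** For the rung-0 local Gibbs law `P` (constant
profiles), any `(N+1)`-body flow `Φ`, a pair `j ≠ i` with enumeration `emb` of the other labels and ANY label
`j' ≠ i`: `P (Φ.good ∩ {t₀(i) ∈ (0, w], first partner j', j' fresh}) = P (ghost event of (i, j, emb))`.  The
transposition `π = swap j j'` fixes `i`; `{z | z ∘ π ∈ F(i, j, emb)} = F(i, j', π ∘ emb)`
(`preimage_comp_perm_firstFlightGhostEvent`), relabelling preserves `P`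
(`EvenStressEnskog.measurePreserving_comp_perm_localGibbsLaw`), and `F(i, j', π ∘ emb)` is a.e. the first-flight
event of `(i, j')` (`measure_firstFlightGhostEvent_eq_of_ac`). [folklore] -/
theorem localGibbsMeasure_firstFlightPairEvent_eq (a θ : ℝ) (u₀ : V3)
    (Φ : HardSphereFlow (Torus.geometry (Fin 3)) (hsDiameter σ N) (N + 1))
    (Ψ : HardSphereFlow (Torus.geometry (Fin 3)) (hsDiameter σ N) m) {i j : Fin (N + 1)} (hji : j ≠ i)
    (emb : Fin m ↪ Fin (N + 1)) (hemb : ∀ k : Fin (N + 1), (∃ l, emb l = k) ↔ (k ≠ i ∧ k ≠ j)) (w : ℝ)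
    {j' : Fin (N + 1)} (hj'i : j' ≠ i) :
    localGibbsMeasure σ (fun _ => a) (fun _ => u₀) (fun _ => θ) N
        (Φ.good ∩ {z : Config (N + 1) (Fin 3) T3 | Φ.nthCollisionTimeOf i 0 z ∈ Set.Ioc 0 w ∧
          Φ.nthPartnerOf i 0 z = j' ∧ ∀ u ∈ Set.Ioo 0 (Φ.nthCollisionTimeOf i 0 z),
            ¬ Participates (Torus.geometry (Fin 3)) (hsDiameter σ N) (Φ.flow u z) j'}) =
      localGibbsMeasure σ (fun _ => a) (fun _ => u₀) (fun _ => θ) N (firstFlightGhostEvent Ψ i j emb w) := by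
  set P : Measure (Config (N + 1) (Fin 3) T3) := localGibbsMeasure σ (fun _ => a) (fun _ => u₀) (fun _ => θ) N
    with hPdef
  have hPac : P ≪ liouville (Torus.geometry (Fin 3)) (N + 1) (hsDiameter σ N) :=
    localGibbsMeasure_absolutelyContinuous σ _ _ _ N Φ
  set π : Equiv.Perm (Fin (N + 1)) := Equiv.swap j j' with hπdef
  have hπi : π i = i := Equiv.swap_apply_of_ne_of_ne hji.symm hj'i.symm
  have hπj : π j = j' := Equiv.swap_apply_left j j'
  have hemb' : ∀ k : Fin (N + 1), (∃ l, (emb.trans π.toEmbedding) l = k) ↔ (k ≠ i ∧ k ≠ j') := by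
    intro k
    rw [exists_emb_trans_perm_iff emb hemb π k, hπi, hπj]
  have hpres : MeasurePreserving
      (fun z : Config (N + 1) (Fin 3) T3 => (z ∘ π : Config (N + 1) (Fin 3) T3)) P P := by
    have h := EvenStressEnskog.measurePreserving_comp_perm_localGibbsLaw σ (fun _ => a) (fun _ => θ)
      (fun _ => u₀) N Φ π
    rwa [localGibbsLaw_eq] at h
  calc P (Φ.good ∩ {z : Config (N + 1) (Fin 3) T3 | Φ.nthCollisionTimeOf i 0 z ∈ Set.Ioc 0 w ∧
          Φ.nthPartnerOf i 0 z = j' ∧ ∀ u ∈ Set.Ioo 0 (Φ.nthCollisionTimeOf i 0 z),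
            ¬ Participates (Torus.geometry (Fin 3)) (hsDiameter σ N) (Φ.flow u z) j'})
      = P (firstFlightGhostEvent Ψ i j' (emb.trans π.toEmbedding) w) :=
        (measure_firstFlightGhostEvent_eq_of_ac Φ Ψ hj'i.symm _ hemb' w hPac).symm
    _ = P ((fun z : Config (N + 1) (Fin 3) T3 => (z ∘ π : Config (N + 1) (Fin 3) T3)) ⁻¹'
          firstFlightGhostEvent Ψ i j emb w) := by
        rw [preimage_comp_perm_firstFlightGhostEvent, hπi, hπj]
    _ = P (firstFlightGhostEvent Ψ i j emb w) :=
        hpres.measure_preimage_emb (EvenStressEnskog.measurableEmbedding_comp_perm π) _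

/-- **The ghost event has local-Gibbs probability `≤ 1/N`.** For the rung-0 local Gibbs law `P` of `N + 1` spheres
with constant profiles (`a > 0`, `θ > 0`, `σ ≤ 1/2`, so that `P` is a probability measure), any `(N+1)`-body flow
`Φ` (only used in the proof), a pair `j ≠ i`, an enumeration `emb` of the other labels, any ghost flow `Ψ` and window
`w`: `P (firstFlightGhostEvent Ψ i j emb w) ≤ N⁻¹` — the `N` numbers `P E_{j'}`, `j' ≠ i`, all equal `P F`
(`localGibbsMeasure_firstFlightPairEvent_eq`) and sum to at most `1` (`sum_measure_firstFlightPairEvent_le_one`).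
[folklore] -/
theorem localGibbsMeasure_firstFlightGhostEvent_le_inv {a θ : ℝ} (ha : 0 < a) (hθ : 0 < θ) (hσ2 : σ ≤ 1 / 2)
    (u₀ : V3) (Φ : HardSphereFlow (Torus.geometry (Fin 3)) (hsDiameter σ N) (N + 1))
    (Ψ : HardSphereFlow (Torus.geometry (Fin 3)) (hsDiameter σ N) m) {i j : Fin (N + 1)} (hji : j ≠ i)
    (emb : Fin m ↪ Fin (N + 1)) (hemb : ∀ k : Fin (N + 1), (∃ l, emb l = k) ↔ (k ≠ i ∧ k ≠ j)) (w : ℝ) :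
    localGibbsMeasure σ (fun _ => a) (fun _ => u₀) (fun _ => θ) N (firstFlightGhostEvent Ψ i j emb w) ≤
      ((N : ℝ≥0∞))⁻¹ := by
  set P : Measure (Config (N + 1) (Fin 3) T3) := localGibbsMeasure σ (fun _ => a) (fun _ => u₀) (fun _ => θ) N
    with hPdef
  haveI : IsProbabilityMeasure P :=
    isProbabilityMeasure_localGibbsMeasure continuous_const continuous_const continuous_const (fun _ => ha)
      (fun _ => hθ) hσ2 N
  have hsum := sum_measure_firstFlightPairEvent_le_one Φ i w P
  rw [Finset.sum_congr rfl fun j' hj' => localGibbsMeasure_firstFlightPairEvent_eq a θ u₀ Φ Ψ hji emb hemb w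
      (Finset.ne_of_mem_erase hj'), Finset.sum_const, Finset.card_erase_of_mem (Finset.mem_univ i),
    Finset.card_univ, Fintype.card_fin, Nat.add_sub_cancel, nsmul_eq_mul] at hsum
  rw [ENNReal.le_inv_iff_mul_le, mul_comm]
  exact hsum

end Events

/-! ## The registered stub -/

/-- **The first-flight ghost event has probability `≤ 1/N` under the product law** (registered stub
`prod_measure_firstFlightGhostEvent_le_inv` of the line `Sketch`): for `μ = posGibbsMeasure 1 ε (N+1)`,
`γ = ⊗ᵢ N(0, θ₀ id)`, any ghost flow `Ψ` of the `N − 1` other spheres, a pair `j ≠ i` with enumeration `emb` of the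
other labels and any window `w`, `(μ ⊗ γ) {zipConfig ∈ firstFlightGhostEvent Ψ i j emb w} ≤ N⁻¹`.  The product law
pushed by `zipConfig` is the rung-0 local Gibbs law (`localGibbsMeasure_rung0_eq_map`), for which this is
`localGibbsMeasure_firstFlightGhostEvent_le_inv` through any `(N+1)`-body flow (Alexander,
`HardSphereFlow.nonempty_torus_holds`, `ε < 1/2` as `σ < 1/2`). [folklore] -/
theorem prod_measure_firstFlightGhostEvent_le_inv : ∀ {θ₀ σ : ℝ}, 0 < θ₀ → 0 < σ → σ < 2⁻¹ → ∀ {N : ℕ}, 1 ≤ N → ∀ (Ψ : Literature.Analysis.FluidPDE.HardSphereFlow (Literature.Analysis.FluidPDE.Torus.geometry (Fin 3)) (Literature.MathematicalPhysics.KineticTheory.hsDiameter σ N) (N - 1)) {i j : Fin (N + 1)}, j ≠ i → ∀ emb : Fin (N - 1) ↪ Fin (N + 1), (∀ k : Fin (N + 1), (∃ l, emb l = k) ↔ (k ≠ i ∧ k ≠ j)) → ∀ w : ℝ, ((Literature.MathematicalPhysics.KineticTheory.posGibbsMeasure (fun _ => (1 : ℝ)) (Literature.MathematicalPhysics.KineticTheory.hsDiameter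 σ N) (N + 1)).prod (MeasureTheory.Measure.pi fun _ : Fin (N + 1) => Literature.MathematicalPhysics.KineticTheory.gaussMeasure (0 : Literature.MathematicalPhysics.KineticTheory.V3) θ₀)) {p | Literature.MathematicalPhysics.KineticTheory.zipConfig p ∈ Summit.AtomisticToContinuum.HydrodynamicLimit.Theorems.OLC.firstFlightGhostEvent Ψ i j emb w} ≤ ((N : ENNReal))⁻¹ := by
  intro θ₀ σ hθ hσ hσ2 N _hN Ψ i j hji emb hemb w
  have hε : 0 < hsDiameter σ N := hsDiameter_pos hσ N
  have hε2 : hsDiameter σ N < 2⁻¹ := (hsDiameter_le hσ.le N).trans_lt hσ2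
  obtain ⟨Φ⟩ := HardSphereFlow.nonempty_torus_holds (d := Fin 3) hε hε2 (N + 1)
  have hzip : MeasurableEmbedding
      (zipConfig : (Fin (N + 1) → T3) × (Fin (N + 1) → V3) → Config (N + 1) (Fin 3) T3) :=
    (MeasurableEquiv.arrowProdEquivProdArrow T3 V3 (Fin (N + 1))).symm.measurableEmbedding
  have h := localGibbsMeasure_firstFlightGhostEvent_le_inv one_pos hθ (by linarith : σ ≤ 1 / 2) (0 : V3) Φ Ψ hji
    emb hemb w
  rw [localGibbsMeasure_rung0_eq_map σ zero_le_one hθ (0 : V3) N, hzip.map_apply] at h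
  exact h

end

end Summit.AtomisticToContinuum.HydrodynamicLimit.Theorems.OLC
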